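import Mathlib

/-!
# LangWeilTransfer, support item `TameResolution` (stmt-ValiantsHypothesis-6378) — small natural
# specialisations avoiding a hypersurface

Route `LangWeilTransfer` of `ValiantsHypothesis` (conditional route; honest framing: bookkeeping,
nothing here bears on VP ≠ VNP). Steps (P)/(N) of the architecture note of val-lit-p6 g9 specialise
indeterminate coefficients (`α ↦ a`, `Λ ↦ c`, shear coefficients) to natural numbers of controlled
size keeping a given non-zero polynomial non-zero:

* `exists_nat_le_eval_ne_zero` — over an integral domain of characteristic `0`, a non-zero
  `P ∈ R[X_σ]` (`σ` finite) with `deg_{X_i} P ≤ N` has a point `x ∈ {0, …, N}^σ` with `P(x) ≠ 0`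
  (Alon's combinatorial Nullstellensatz, Mathlib `MvPolynomial.eq_zero_of_eval_zero_at_prod_finset`).
* `exists_nat_le_map_ne_zero` — the same for a polynomial with coefficients in `R[X_σ]`
  (a point where some coefficient survives, so the specialised polynomial is non-zero).
-/

noncomputable section

open MvPolynomial

-- the summit and the problem share the name `ValiantsHypothesis` (D-0017 single-conjunct layout)
set_option linter.dupNamespace false

namespace Summit.ValiantsHypothesis.ValiantsHypothesis.Theorems.LangWeilTransfer

variable {R : Type*} [CommRing R] [IsDomain R] [CharZero R] {σ : Type*} [Finite σ]

/-- **Small natural point off a hypersurface.** A non-zero `P ∈ R[X_σ]` over a domain of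
characteristic `0` with all partial degrees `≤ N` does not vanish at some `x ∈ {0, …, N}^σ`. -/
theorem exists_nat_le_eval_ne_zero (P : MvPolynomial σ R) (hP : P ≠ 0) {N : ℕ}
    (hdeg : ∀ i, P.degreeOf i ≤ N) :
    ∃ x : σ → ℕ, (∀ i, x i ≤ N) ∧ eval (fun i => (x i : R)) P ≠ 0 := by
  classical
  by_contra h
  push Not at h
  apply hP
  refine MvPolynomial.eq_zero_of_eval_zero_at_prod_finset P
    (fun _ => (Finset.range (N + 1)).image (fun k : ℕ => (k : R))) (fun i => ?_) (fun y hy => ?_)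
  · rw [Finset.card_image_of_injective _ Nat.cast_injective, Finset.card_range]
    exact Nat.lt_succ_of_le (hdeg i)
  · -- `y i = x i` with `x i ≤ N`
    have hx : ∀ i, ∃ k : ℕ, k ≤ N ∧ (k : R) = y i := fun i => by
      obtain ⟨k, hk, hky⟩ := Finset.mem_image.1 (hy i)
      exact ⟨k, Nat.lt_succ_iff.1 (Finset.mem_range.1 hk), hky⟩
    choose x hxN hxy using hx
    have : y = fun i => (x i : R) := funext fun i => (hxy i).symm
    rw [this]
    exact h x hxN

/-- **Small natural specialisation keeping a polynomial non-zero.** For a non-zero polynomial `Q`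
in further variables `U…` (any index type `κ`) with coefficients in `R[X_σ]` all of partial degrees
`≤ N`, some `x ∈ {0, …, N}^σ` keeps `Q` non-zero after the coefficientwise specialisation
`X_σ ↦ x`. -/
theorem exists_nat_le_map_ne_zero {κ : Type*} (Q : MvPolynomial κ (MvPolynomial σ R)) (hQ : Q ≠ 0)
    {N : ℕ} (hdeg : ∀ m i, (Q.coeff m).degreeOf i ≤ N) :
    ∃ x : σ → ℕ, (∀ i, x i ≤ N) ∧ MvPolynomial.map (eval fun i => (x i : R)) Q ≠ 0 := by
  classical
  obtain ⟨m, hm⟩ := MvPolynomial.ne_zero_iff.1 hQ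
  obtain ⟨x, hxN, hx⟩ := exists_nat_le_eval_ne_zero (Q.coeff m) hm (hdeg m)
  refine ⟨x, hxN, fun h0 => hx ?_⟩
  have := congrArg (MvPolynomial.coeff m) h0
  rwa [coeff_map, coeff_zero] at this

end Summit.ValiantsHypothesis.ValiantsHypothesis.Theorems.LangWeilTransfer
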